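import Mathlib

/-!
# Lattice glue for the assembly steps (MC and Stevens I′)

Blind cell `pub-manin-gamma0`, seat p3 (generation 2).  Two elementary facts that close the chain on paper
(`proofs/ManinCorollary_p3.md` steps (3)–(5); `proofs/R2_UBD_Honda_lattice_p3.md` §4 C3; `proofs/REFEREE_VERSION_p3g2.md` Cor. (i)–(iii)):

* `natAbs_eq_one_of_forall_not_le` (MC assembly): if `Λ₁ ⊆ c·Λ₀` for an integer `c ≠ 0` (this is what R2 gives for a lattice-optimal datum on a
  minimal model) and `Λ₁ ⊄ m·Λ₀` for every `m ≥ 2` (T1 for `m = 2`, T3/Weil pairing for `m ≥ 3`), then `|c| = 1`.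
* `subsingleton_of_forall_eq_smul` (Stevens I′ lattice step): a free `ℤ`-module in which every element is divisible by a fixed integer `c` with
  `|c| ≥ 2` is trivial; hence (`natAbs_le_one_of_forall_eq_smul`) a non-trivial free `ℤ`-module with `Λ ⊆ c·Λ` has `|c| ≤ 1` — applied to
  `Λ₁ ⊆ 𝓛(A₁) = c₁Λ₁` this is `c₁ = ±1`.
Only Mathlib is imported; no definitions are introduced.
-/

namespace ManinGamma
namespace LatticeGlue

/-- **MC assembly.**  `Λ₁ ⊆ c·Λ₀` (`c ≠ 0`) and `Λ₁ ⊄ m·Λ₀` for all `m ≥ 2` force `|c| = 1`. -/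
theorem natAbs_eq_one_of_forall_not_le {G : Type*} [AddCommGroup G] (Λ₀ Λ₁ : AddSubgroup G) (c : ℤ) (hc : c ≠ 0)
    (hR2 : ∀ x ∈ Λ₁, ∃ y ∈ Λ₀, x = c • y)
    (hT : ∀ m : ℕ, 2 ≤ m → ¬ ∀ x ∈ Λ₁, ∃ y ∈ Λ₀, x = (m : ℤ) • y) : c.natAbs = 1 := by
  by_contra h1
  have h2 : 2 ≤ c.natAbs := by
    have := Int.natAbs_ne_zero.mpr hc
    omega
  apply hT c.natAbs h2
  intro x hx
  obtain ⟨y, hy, hxy⟩ := hR2 x hx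
  rcases Int.natAbs_eq c with e | e
  · exact ⟨y, hy, by rw [← e]; exact hxy⟩
  · refine ⟨-y, Λ₀.neg_mem hy, ?_⟩
    rw [smul_neg, ← neg_smul, ← e]; exact hxy

/-- An integer divisible by every power of an integer `c` with `|c| ≥ 2` is `0`. -/
theorem eq_zero_of_forall_pow_dvd (c a : ℤ) (hc : 2 ≤ c.natAbs) (h : ∀ k : ℕ, c ^ k ∣ a) : a = 0 := by
  apply Int.eq_zero_of_dvd_of_natAbs_lt_natAbs (h a.natAbs)
  rw [Int.natAbs_pow]
  calc a.natAbs < 2 ^ a.natAbs := Nat.lt_two_pow_self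
    _ ≤ c.natAbs ^ a.natAbs := Nat.pow_le_pow_left hc _

/-- **Stevens I′ lattice step.**  In a free `ℤ`-module, if every element is `c` times an element, with `|c| ≥ 2`, then every element is `0`. -/
theorem eq_zero_of_forall_eq_smul {M : Type*} [AddCommGroup M] {ι : Type*} (b : Module.Basis ι ℤ M) (c : ℤ) (hc : 2 ≤ c.natAbs)
    (h : ∀ x : M, ∃ y : M, x = c • y) (x : M) : x = 0 := by
  -- every element is divisible by every power of c
  have hk : ∀ k : ℕ, ∀ x : M, ∃ y : M, x = c ^ k • y := by
    intro k
    induction k with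
    | zero => intro x; exact ⟨x, by simp⟩
    | succ k ih =>
      intro x
      obtain ⟨y, hy⟩ := ih x
      obtain ⟨z, hz⟩ := h y
      exact ⟨z, by rw [hy, hz, smul_smul, pow_succ]⟩
  -- hence every coordinate is divisible by every power of c, hence 0
  have hcoord : ∀ i, b.repr x i = 0 := by
    intro i
    apply eq_zero_of_forall_pow_dvd c _ hc
    intro k
    obtain ⟨y, hy⟩ := hk k x
    refine ⟨b.repr y i, ?_⟩
    rw [hy, map_smul, Finsupp.smul_apply, smul_eq_mul]
  have : b.repr x = 0 := Finsupp.ext hcoord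
  exact b.repr.map_eq_zero_iff.mp this

/-- Consequently: a free `ℤ`-module with a non-zero element, in which `Λ ⊆ c·Λ`, has `|c| ≤ 1` (so `c = ±1` if `c ≠ 0`). -/
theorem natAbs_le_one_of_forall_eq_smul {M : Type*} [AddCommGroup M] {ι : Type*} (b : Module.Basis ι ℤ M) (c : ℤ)
    (h : ∀ x : M, ∃ y : M, x = c • y) (x₀ : M) (hx₀ : x₀ ≠ 0) : c.natAbs ≤ 1 := by
  by_contra hc
  exact hx₀ (eq_zero_of_forall_eq_smul b c (by omega) h x₀)

end LatticeGlue
end ManinGamma
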